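import Summits.CriticalPhenomena.PercolationContinuityZ3.Theorems.Transplant.Slab111SK4Defs
import Summits.CriticalPhenomena.PercolationContinuityZ3.Theorems.Transplant.Slab111SKBits
import HarnessLib

/-!
# Small thickness `(111)`-films, radius FOUR, II: BIT LEMMAS for the radius-4 kernel checker — neighbourhoods, reachability, re-validated paths

builds on p205010 (kernel theorem, internal audit signed; external expert review pending) — NOT used in this file.  Lane `prim-bschramm`, seat
`prim-bschramm-p2` (gen 38; class C1b; memo `HOME/bschramm/P2-LATTICES.md` §136); helper file (`--supports stmt-CriticalPhenomena-4575 --as helper`).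
Radius-4 twin of «Slab111SKBits» (the layout-free lemmas there are reused): the neighbourhood `nbh4` (a set bit has an `AdjRel4`-neighbour in the argument),
**`reach4_sound`** (a reachable bit is the end of an `AdjRel4`-walk inside the region), **`pathOK4_sound`**.  «Slab111SK4Geo» interprets indices as film vertices.
[cite: DuminilCopinSidoraviciusTassion2016, §2.3 (proof of Fact 2)]
-/

namespace Summit.CriticalPhenomena.PercolationContinuityZ3.Theorems.Transplant

namespace Slab111.SK4

open Slab111.SK (bitOf sdiff maskBelow maskOfList endsOK orFold rd rdMask testBit_bitOf testBit_sdiff)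

/-! ## §1 Masks -/

/-- Index adjacency as a proposition. [folklore] -/
def AdjRel4 (i j : ℕ) : Prop := j = i + 156 ∨ j = i + 143 ∨ j = i + 133 ∨ i = j + 156 ∨ i = j + 143 ∨ i = j + 133

/-- `adjB4` decides `AdjRel4`. [folklore] -/
theorem adjB4_iff {i j : ℕ} : adjB4 i j = true ↔ AdjRel4 i j := by
  simp only [adjB4, AdjRel4, Bool.or_eq_true, beq_iff_eq, or_assoc]

/-- `AdjRel4` is symmetric. [folklore] -/
theorem AdjRel4.symm {i j : ℕ} (h : AdjRel4 i j) : AdjRel4 j i := by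
  unfold AdjRel4 at *; omega

/-! ## §2 Neighbourhoods and reachability -/

/-- **A bit of the neighbourhood mask has an adjacent bit in the argument** (and lies in the universe). [folklore] -/
theorem testBit_nbh4 {u m j : ℕ} (h : (nbh4 u m).testBit j = true) : u.testBit j = true ∧ ∃ i, m.testBit i = true ∧ AdjRel4 i j := by
  unfold nbh4 at h
  rw [Nat.testBit_land, Bool.and_eq_true] at h
  refine ⟨h.2, ?_⟩
  have h1 := h.1
  simp only [Nat.testBit_lor, Bool.or_eq_true, Nat.testBit_shiftLeft, Nat.testBit_shiftRight, Bool.and_eq_true,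
    decide_eq_true_eq] at h1
  unfold AdjRel4
  rcases h1 with ((((⟨h1, h2⟩ | ⟨h1, h2⟩) | ⟨h1, h2⟩) | h2) | h2) | h2
  · exact ⟨j - 156, h2, by omega⟩
  · exact ⟨j - 143, h2, by omega⟩
  · exact ⟨j - 133, h2, by omega⟩
  · exact ⟨156 + j, h2, by omega⟩
  · exact ⟨143 + j, h2, by omega⟩
  · exact ⟨133 + j, h2, by omega⟩

/-- **An index walk inside a region**: an `AdjRel4`-chain `s :: l` all of whose members are bits of `R`. [folklore] -/
def IsWalkIn4 (R : ℕ) (s : ℕ) (l : List ℕ) : Prop := (s :: l).IsChain AdjRel4 ∧ ∀ x ∈ s :: l, R.testBit x = true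

/-- The end of the walk `s :: l`. [folklore] -/
def walkEnd4 (s : ℕ) (l : List ℕ) : ℕ := (s :: l).getLast (List.cons_ne_nil _ _)

/-- Extending a walk by an adjacent region vertex. [folklore] -/
theorem IsWalkIn4.snoc {R s : ℕ} {l : List ℕ} (h : IsWalkIn4 R s l) {j : ℕ} (hadj : AdjRel4 (walkEnd4 s l) j) (hj : R.testBit j = true) :
    IsWalkIn4 R s (l ++ [j]) ∧ walkEnd4 s (l ++ [j]) = j := by
  refine ⟨⟨?_, ?_⟩, ?_⟩
  · have : s :: (l ++ [j]) = (s :: l) ++ [j] := rfl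
    rw [this, List.isChain_append]
    refine ⟨h.1, List.IsChain.singleton _, fun x hx y hy => ?_⟩
    rw [List.getLast?_eq_some_getLast (List.cons_ne_nil _ _), Option.mem_def, Option.some.injEq] at hx
    simp only [List.head?_cons, Option.mem_def, Option.some.injEq] at hy
    subst hx hy; exact hadj
  · intro x hx
    simp only [List.mem_cons, List.mem_append, List.not_mem_nil, or_false] at hx
    rcases hx with rfl | hx | rfl
    · exact h.2 _ (by simp)
    · exact h.2 _ (List.mem_cons_of_mem _ hx)
    · exact hj
  · show ((s :: l) ++ [j]).getLast _ = j
    simp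

/-- **SOUNDNESS OF `reachGo4`**: if every bit of `cur` is the end of a walk from a bit of `src` inside `R`, the same holds for the result. [folklore] -/
theorem reachGo4_sound (u R src : ℕ) :
    ∀ (f cur : ℕ), (∀ j, cur.testBit j = true → ∃ s l, src.testBit s = true ∧ IsWalkIn4 R s l ∧ walkEnd4 s l = j) →
      ∀ j, (reachGo4 u R f cur).testBit j = true → ∃ s l, src.testBit s = true ∧ IsWalkIn4 R s l ∧ walkEnd4 s l = j := by
  intro f
  induction f with
  | zero => intro cur hcur j hj; exact hcur j hj
  | succ f ih =>
    intro cur hcur j hj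
    simp only [reachGo4] at hj
    -- the next set
    have hnxt : ∀ j, ((cur ||| nbh4 u cur) &&& R).testBit j = true → ∃ s l, src.testBit s = true ∧ IsWalkIn4 R s l ∧ walkEnd4 s l = j := by
      intro j hj
      rw [Nat.testBit_land, Bool.and_eq_true, Nat.testBit_lor, Bool.or_eq_true] at hj
      rcases hj with ⟨hj | hj, hR⟩
      · exact hcur j hj
      · obtain ⟨-, i, hi, hadj⟩ := testBit_nbh4 hj
        obtain ⟨s, l, hs, hw, he⟩ := hcur i hi
        subst he
        exact ⟨s, l ++ [j], hs, (hw.snoc hadj hR).1, (hw.snoc hadj hR).2⟩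
    cases hb : ((cur ||| nbh4 u cur) &&& R == cur)
    · rw [hb] at hj; exact ih _ hnxt j hj
    · rw [hb] at hj; exact hcur j hj

/-- **SOUNDNESS OF `reach4`**: a reachable bit is the end of an index walk inside the region from a bit of `src ∩ region`. [folklore] -/
theorem reach4_sound {u R src j : ℕ} (h : (reach4 u R src).testBit j = true) :
    ∃ s l, src.testBit s = true ∧ R.testBit s = true ∧ IsWalkIn4 R s l ∧ walkEnd4 s l = j := by
  unfold reach4 at h
  have base : ∀ j, (src &&& R).testBit j = true → ∃ s l, (src &&& R).testBit s = true ∧ IsWalkIn4 R s l ∧ walkEnd4 s l = j := by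
    intro j hj
    refine ⟨j, [], hj, ⟨List.IsChain.singleton _, fun x hx => ?_⟩, rfl⟩
    simp only [List.mem_cons, List.not_mem_nil, or_false] at hx
    subst hx
    rw [Nat.testBit_land, Bool.and_eq_true] at hj
    exact hj.2
  obtain ⟨s, l, hs, hw, he⟩ := reachGo4_sound u R (src &&& R) 300 _ base j h
  rw [Nat.testBit_land, Bool.and_eq_true] at hs
  exact ⟨s, l, hs.1, hs.2, hw, he⟩

/-! ## §3 Re-validated paths -/

/-- **SOUNDNESS OF `pathOK4`**: an `AdjRel4`-chain without repetitions, inside `reg`, off `seen`. [folklore] -/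
theorem pathOK4_sound (reg : ℕ) : ∀ (l : List ℕ) (seen : ℕ), pathOK4 reg l seen = true →
    l.IsChain AdjRel4 ∧ l.Nodup ∧ ∀ x ∈ l, reg.testBit x = true ∧ seen.testBit x = false
  | [], _, _ => ⟨List.IsChain.nil, List.nodup_nil, fun _ h => nomatch h⟩
  | [i], seen, h => by
    simp only [pathOK4, Bool.and_eq_true, Bool.not_eq_true'] at h
    exact ⟨List.IsChain.singleton _, List.nodup_singleton _, fun x hx => by simp only [List.mem_singleton] at hx; subst hx; exact h⟩
  | i :: j :: rest, seen, h => by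
    simp only [pathOK4, Bool.and_eq_true, Bool.not_eq_true'] at h
    obtain ⟨⟨⟨hi, hsi⟩, hij⟩, hrest⟩ := h
    obtain ⟨hch, hnd, hmem⟩ := pathOK4_sound reg (j :: rest) (seen ||| bitOf i) hrest
    refine ⟨List.isChain_cons_cons.2 ⟨adjB4_iff.1 hij, hch⟩, List.nodup_cons.2 ⟨fun hmi => ?_, hnd⟩, fun x hx => ?_⟩
    · have := (hmem i hmi).2
      rw [Nat.testBit_lor, testBit_bitOf] at this
      simp at this
    · rcases List.mem_cons.1 hx with rfl | hx
      · exact ⟨hi, hsi⟩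
      · have := hmem x hx
        rw [Nat.testBit_lor, Bool.or_eq_false_iff] at this
        exact ⟨this.1, this.2.1⟩

end Slab111.SK4

end Summit.CriticalPhenomena.PercolationContinuityZ3.Theorems.Transplant
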